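import Mathlib
import HarnessLib
import Summits.HubbardSuperconductivity.HubbardSuperconductivity.Theorems.KLProgrammePerturbedFermiCurveHigherDerivsBand

/-!
# Route `KLProgramme` — the FRAME's Fermi radius `u_K` at third and fourth order, SHARP: `|u_K‴| = O(1 + A₃)`,
# `|u_K⁗| = O(1 + A₃ + A₄)` in the frame's order-3/4 sizes, and the `FrameOK`-keyed form in the KL regime

Cell `gate-hubbard-kl`, seat hubbard-kl-k3c3-p3 (g2; row «implicit-function / monotonicity route»).  The frame-side input of the ENGINE
child's (stmt-HubbardSuperconductivity-19823) two-leg stubs ((E3g) `TwoLegAngularG`, `j ≤ 4`, via p1b's `twoLegAngularG_of_curve_bounds` /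
`twoLegAngularG_of_moments`): p1b g5's finding N-(E3g) (STATUS 2026-08-26T22:58Z) — the single-constant bootstrap bound
`|u_K^{(j)}| ≤ (31104·B⁴/d⁴)ʲ` grows like `4^{8jN}` and cannot fit the frozen majorant `angBar … j ∝ 4^{j(N+1)}`; «the alternative (keep
`angBar`) needs sharp hand-derived `u‴, u⁗` formulas».  This module is that alternative, assembled from `…HigherDerivsBand`
(`abs_deriv_three/four_le_of_isRoot`, affine in the top-order sizes):

* §1 transport of a SINGLE-ORDER size `‖Dʲ(frameShift K)‖ ≤ A_j` on `Momentum` to the sup-norm setting (`‖Dʲδ_K‖ ≤ 2ʲA_j`, nested form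
  for `j = 3, 4`), and the per-order sizes of an ADMISSIBLE frame: `‖Dʲ(frameShift K)‖ ≤ Σ_{n≤N} Gfr j·uPow j U·4^{(j−2)n}` for every
  `j ≤ 4` (`FrameOK` (ii) summed WITHOUT the crude `4^{(j−2)n} ≤ 4^{2N}`), with `Σ_{n≤N} 4ⁿ ≤ 4^{N+1}/3`, `Σ_{n≤N} 16ⁿ ≤ 16^{N+1}/15`;
* §2 for a frame `K` with `C²` size `A` (`j ≤ 2`, `2A < Dt_min`, margins) and order-3/4 sizes `A₃, A₄`:
  `|u_K′| ≤ (4+2A)π√2/(Dt_min−2A)`, and from `|u_K′ θ| ≤ R₁`, `|u_K″ θ| ≤ R₂`, `|u_K‴ θ| ≤ R₃`: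
  `|u_K″ θ| ≤ ((4+4A)K₁² + (4+2A)(2R₁+π√2))/(Dt_min−2A)`,
  `|u_K‴ θ| ≤ ((4+8A₃)K₁³ + 3(4+4A)K₁K₂ + (4+2A)(3R₂+3R₁+π√2))/(Dt_min−2A)`,
  `|u_K⁗ θ| ≤ ((4+16A₄)K₁⁴ + 6(4+8A₃)K₁²K₂ + 3(4+4A)K₂² + 4(4+4A)K₁K₃ + (4+2A)(4R₃+6R₂+4R₁+π√2))/(Dt_min−2A)`
  (`K₁ = R₁+π√2`, `K₂ = R₂+2R₁+π√2`, `K₃ = R₃+3R₂+3R₁+π√2`) — LINEAR in `A₃`, `A₄`;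
* §3 keyed by `FrameOK R U (nScales β) μ K` in the KL regime (`0 < c ≤ c₃(R)`, `0 < U ≤ U₀(R)`, `klBetaMin ≤ β ≤ e^{c/U²}`, `μ ∈ klWindowC`):
  `A = 2Gfr₀U + 2Gfr₁U² + Gfr₂c/log 4 ≤ 1/20`, `2A ≤ Dt_min/2`, `A₃ = Gfr₃·U²·Σ_{n≤N}4ⁿ`, `A₄ = Gfr₄·U²·Σ_{n≤N}16ⁿ` — so
  `|u_K′|, |u_K″| = O(1)`, `|u_K‴| = O(1 + Gfr₃U²4^{N})`, `|u_K⁗| = O(1 + Gfr₃U²4^N + Gfr₄U²4^{2N})`: the graded growth `(2^{N+1})ⁱ ≤`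
  `angBar`'s `4^{i(N+1)}` room — i.e. N-(E3g) is an artefact of the crude bootstrap, not of the frozen text.

Everything is PROVED; no definitions, nothing about the Hubbard model.  References: BGM 2006 §2.4 Lemma 2.1 (2.40)
[cite: BenfattoGiulianiMastropietro2006]; HOME/prover-p1b/g5/E3-CERT-NOTE.md §2/§5.
-/

noncomputable section

namespace Summit.HubbardSuperconductivity.HubbardSuperconductivity.Theorems.PerturbedFermiCurve

set_option linter.dupNamespace false -- summit = problem name (single-conjunct summit), D-0017
set_option maxSynthPendingDepth 3 -- nested operator-norm instances (third/fourth Fréchet derivatives)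

open Real Set Finset
open Literature.MathematicalPhysics.QuantumLattice Literature.MathematicalPhysics.QuantumLattice.BandSectorCounting
open Summit.HubbardSuperconductivity.HubbardSuperconductivity.Theorems.DispersionFlow
open Summit.HubbardSuperconductivity.HubbardSuperconductivity.Theorems.KLRegimeSplit

/-! ## §1 Single-order sizes of the frame: transport to `Fin 2 → ℝ`, and the per-order sizes of an admissible frame -/

/-- **Single-order transport**: `‖Dʲ(frameShift K)‖ ≤ A_j` on `Momentum` gives `‖Dʲ δ_K(k)‖ ≤ A_j·2ʲ` on `Fin 2 → ℝ`
(`δ_K = frameShift K ∘ toLp`, `‖toLp‖ ≤ 2`; p1b's `…_le_of_order` is the all-orders-`≤ N` form). -/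
theorem norm_iteratedFDeriv_frameShift_toLp_le_single {K : TrigPolyC4v} {Aj : ℝ} {j : ℕ}
    (hAj : ∀ p : Momentum, ‖iteratedFDeriv ℝ j (frameShift K) p‖ ≤ Aj) (k : Fin 2 → ℝ) :
    ‖iteratedFDeriv ℝ j (fun k : Fin 2 → ℝ => frameShift K (WithLp.toLp 2 k)) k‖ ≤ Aj * 2 ^ j := by
  set T := ((EuclideanSpace.equiv (Fin 2) ℝ).symm : (Fin 2 → ℝ) →L[ℝ] Momentum) with hT
  have hC : ContDiff ℝ j (frameShift K) := contDiff_frameShift K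
  rw [frameShift_toLp_eq_comp, ContinuousLinearMap.iteratedFDeriv_comp_right T hC k le_rfl]
  have h1 := ContinuousMultilinearMap.norm_compContinuousLinearMap_le (iteratedFDeriv ℝ j (frameShift K) (T k))
    (fun _ : Fin j => T)
  have hA0 : 0 ≤ Aj := le_trans (norm_nonneg _) (hAj (T k))
  calc _ ≤ ‖iteratedFDeriv ℝ j (frameShift K) (T k)‖ * ∏ _i : Fin j, ‖T‖ := h1
    _ ≤ Aj * 2 ^ j := by
        rw [Finset.prod_const, Finset.card_univ, Fintype.card_fin]
        exact mul_le_mul (hAj _) (pow_le_pow_left₀ (norm_nonneg _) norm_toLpCLM_le j) (by positivity) hA0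

/-- Order 3, nested form: `‖D³δ_K(k)‖ ≤ 8A₃`. -/
theorem norm_fderiv_three_frameShift_le {K : TrigPolyC4v} {A₃ : ℝ}
    (hA₃ : ∀ p : Momentum, ‖iteratedFDeriv ℝ 3 (frameShift K) p‖ ≤ A₃) (k : Fin 2 → ℝ) :
    ‖fderiv ℝ (fderiv ℝ (fderiv ℝ (fun p : Fin 2 → ℝ => -K.eval p))) k‖ ≤ 8 * A₃ := by
  rw [norm_fderiv_three_eq_norm_iteratedFDeriv, ← frameShift_toLp_eq_neg_eval]
  have h := norm_iteratedFDeriv_frameShift_toLp_le_single hA₃ k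
  linarith

/-- Order 4, nested form: `‖D⁴δ_K(k)‖ ≤ 16A₄`. -/
theorem norm_fderiv_four_frameShift_le {K : TrigPolyC4v} {A₄ : ℝ}
    (hA₄ : ∀ p : Momentum, ‖iteratedFDeriv ℝ 4 (frameShift K) p‖ ≤ A₄) (k : Fin 2 → ℝ) :
    ‖fderiv ℝ (fderiv ℝ (fderiv ℝ (fderiv ℝ (fun p : Fin 2 → ℝ => -K.eval p)))) k‖ ≤ 16 * A₄ := by
  rw [norm_fderiv_four_eq_norm_iteratedFDeriv, ← frameShift_toLp_eq_neg_eval]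
  have h := norm_iteratedFDeriv_frameShift_toLp_le_single hA₄ k
  linarith

/-- **Per-order sizes of an admissible frame** (no crude `4^{2N}`): `FrameOK R U N μ K` gives, for every `j ≤ 4` and every `p`,
`‖Dʲ(frameShift K)(p)‖ ≤ Σ_{n ≤ N} Gfr j · uPow j U · 4^{(j−2)n}`. -/
theorem norm_iteratedFDeriv_frameShift_le_sum_of_frameOK {R : RenConsts} {U : ℝ} {N : ℕ} {μ : ℝ} {K : TrigPolyC4v}
    (hK : FrameOK R U N μ K) (p : Momentum) {j : ℕ} (hj : j ≤ 4) :
    ‖iteratedFDeriv ℝ j (frameShift K) p‖ ≤ ∑ n ∈ range (N + 1), R.Gfr j * uPow j U * (4 : ℝ) ^ (((j : ℤ) - 2) * n) := by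
  obtain ⟨-, Kp, hsum, hS⟩ := hK
  have hfs : frameShift K = fun q => ∑ n ∈ range (N + 1), (fun q => -evalM (Kp n) q) q := by
    funext q
    simp only [frameShift, evalM, hsum (WithLp.ofLp q), Finset.sum_neg_distrib]
  rw [hfs, iteratedFDeriv_fun_sum_apply fun n _ => ((contDiff_evalM (Kp n)).neg).contDiffAt]
  refine (norm_sum_le _ _).trans (sum_le_sum fun n hn => ?_)
  have hn' : n ≤ N := Nat.lt_succ_iff.mp (mem_range.mp hn)
  have h := hS n hn' j hj p
  have e : (fun q => -evalM (Kp n) q) = -evalM (Kp n) := rfl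
  rw [e, iteratedFDeriv_neg_apply, norm_neg]
  exact h

/-- `Σ_{n ≤ N} 4^{((3:ℤ)−2)·n} ≤ 4^{N+1}/3` (the order-3 geometric sum). -/
theorem sum_four_zpow_order_three_le (N : ℕ) :
    ∑ n ∈ range (N + 1), (4 : ℝ) ^ ((((3 : ℕ) : ℤ) - 2) * n) ≤ (4 : ℝ) ^ (N + 1) / 3 := by
  have hre : ∀ n : ℕ, (4 : ℝ) ^ ((((3 : ℕ) : ℤ) - 2) * n) = (4 : ℝ) ^ n := by
    intro n
    rw [show (((3 : ℕ) : ℤ) - 2) * n = (n : ℤ) by push_cast; ring, zpow_natCast]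
  simp_rw [hre]
  have hgeom : ∀ M : ℕ, ∑ n ∈ range M, (4 : ℝ) ^ n = ((4 : ℝ) ^ M - 1) / 3 := by
    intro M
    induction M with
    | zero => simp
    | succ M ih => rw [sum_range_succ, ih, pow_succ]; ring
  rw [hgeom]
  have : (0 : ℝ) < (4 : ℝ) ^ (N + 1) := by positivity
  linarith

/-- `Σ_{n ≤ N} 4^{((4:ℤ)−2)·n} ≤ 16^{N+1}/15` (the order-4 geometric sum). -/
theorem sum_four_zpow_order_four_le (N : ℕ) :
    ∑ n ∈ range (N + 1), (4 : ℝ) ^ ((((4 : ℕ) : ℤ) - 2) * n) ≤ (16 : ℝ) ^ (N + 1) / 15 := by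
  have hre : ∀ n : ℕ, (4 : ℝ) ^ ((((4 : ℕ) : ℤ) - 2) * n) = (16 : ℝ) ^ n := by
    intro n
    rw [show (((4 : ℕ) : ℤ) - 2) * n = ((2 * n : ℕ) : ℤ) by push_cast; ring, zpow_natCast, pow_mul]
    norm_num
  simp_rw [hre]
  have hgeom : ∀ M : ℕ, ∑ n ∈ range M, (16 : ℝ) ^ n = ((16 : ℝ) ^ M - 1) / 15 := by
    intro M
    induction M with
    | zero => simp
    | succ M ih => rw [sum_range_succ, ih, pow_succ]; ring
  rw [hgeom]
  have : (0 : ℝ) < (16 : ℝ) ^ (N + 1) := by positivity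
  linarith

/-! ## §2 The frame's Fermi radius to order four, sharp in the top-order sizes -/

section Frame

variable {a b : ℝ} (B : BandBounds a b) {K : TrigPolyC4v} {A : ℝ}
  (hA : ∀ p : Momentum, ∀ j ≤ 2, ‖iteratedFDeriv ℝ j (frameShift K) p‖ ≤ A) (hADt : 2 * A < B.Dtmin)
  {μ : ℝ} (hlo : a ≤ μ - A) (hhi : μ + A ≤ b)
include B hA hADt hlo hhi

omit hADt in
/-- The lineage's hypotheses for `δ_K = -K`: `C⁴`, `|δ_K| ≤ A`, `‖Dδ_K‖ ≤ 2A`, `‖D²δ_K‖ ≤ 4A` on the closed square, and the canonical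
radius is a root selection. -/
theorem frame_band_data :
    ContDiff ℝ 4 (fun p : Fin 2 → ℝ => -K.eval p) ∧
      (∀ k : Fin 2 → ℝ, (∀ i, |k i| ≤ π) → |(fun p : Fin 2 → ℝ => -K.eval p) k| ≤ A) ∧
      (∀ k : Fin 2 → ℝ, (∀ i, |k i| ≤ π) → ‖fderiv ℝ (fun p : Fin 2 → ℝ => -K.eval p) k‖ ≤ 2 * A) ∧
      (∀ k : Fin 2 → ℝ, (∀ i, |k i| ≤ π) → ‖fderiv ℝ (fderiv ℝ (fun p : Fin 2 → ℝ => -K.eval p)) k‖ ≤ 4 * A) ∧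
      ∀ θ, IsBandFermiRadius (μ - (fun p : Fin 2 → ℝ => -K.eval p)
        (perturbedFermiRadius (fun p : Fin 2 → ℝ => -K.eval p) μ θ • dir θ)) θ
        (perturbedFermiRadius (fun p : Fin 2 → ℝ => -K.eval p) μ θ) := by
  refine ⟨?_, fun k _ => ?_, fun k _ => ?_, fun k _ => ?_, isBandFermiRadius_klFermiRadius B hA hlo hhi⟩
  · rw [← frameShift_toLp_eq_neg_eval]; exact contDiff_frameShift_toLp K
  · simpa [frameShift_toLp] using abs_frameShift_toLp_le hA k
  · rw [← frameShift_toLp_eq_neg_eval]; exact norm_fderiv_frameShift_toLp_le hA k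
  · rw [← frameShift_toLp_eq_neg_eval]; exact norm_fderiv_fderiv_frameShift_toLp_le hA k

/-- **Uniform slope bound of the frame's Fermi radius**: `|u_K′ θ| ≤ (4 + 2A)·π√2/(Dt_min − 2A)`. -/
theorem abs_deriv_frameRadius_le_uniform (θ : ℝ) :
    |deriv (perturbedFermiRadius (fun p : Fin 2 → ℝ => -K.eval p) μ) θ| ≤ (4 + 2 * A) * (π * Real.sqrt 2) / (B.Dtmin - 2 * A) := by
  obtain ⟨hC, hδ, hκ, -, hroot⟩ := frame_band_data B hA hlo hhi
  exact abs_deriv_le_uniform B hC hδ hlo hhi hκ hADt hroot θ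

/-- **Order 2 of the frame's Fermi radius (incremental)**: from `|u_K′ θ| ≤ R₁`,
`|u_K″ θ| ≤ ((4+4A)(R₁+π√2)² + (4+2A)(2R₁+π√2))/(Dt_min − 2A)`. -/
theorem abs_deriv_two_frameRadius_le {θ R₁ : ℝ} (hR₁ : |deriv (perturbedFermiRadius (fun p : Fin 2 → ℝ => -K.eval p) μ) θ| ≤ R₁) :
    |deriv (deriv (perturbedFermiRadius (fun p : Fin 2 → ℝ => -K.eval p) μ)) θ| ≤
      ((4 + 4 * A) * (R₁ + π * Real.sqrt 2) ^ 2 + (4 + 2 * A) * (2 * R₁ + π * Real.sqrt 2)) / (B.Dtmin - 2 * A) := by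
  obtain ⟨hC, hδ, hκ, hκ₂, hroot⟩ := frame_band_data B hA hlo hhi
  exact abs_deriv_two_le_of_isRoot B hC hδ hlo hhi hκ hADt hroot hκ₂ hR₁

/-- **Order 3 of the frame's Fermi radius, SHARP (linear in `A₃`)**: from `|u_K′ θ| ≤ R₁`, `|u_K″ θ| ≤ R₂` and the order-3 size
`‖D³(frameShift K)‖ ≤ A₃`:
`|u_K‴ θ| ≤ ((4+8A₃)(R₁+π√2)³ + 3(4+4A)(R₁+π√2)(R₂+2R₁+π√2) + (4+2A)(3R₂+3R₁+π√2))/(Dt_min − 2A)`.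
[cite: BenfattoGiulianiMastropietro2006, §2.4 Lemma 2.1 (2.40)] -/
theorem abs_deriv_three_frameRadius_le {A₃ : ℝ} (hA₃ : ∀ p : Momentum, ‖iteratedFDeriv ℝ 3 (frameShift K) p‖ ≤ A₃)
    {θ R₁ R₂ : ℝ} (hR₁ : |deriv (perturbedFermiRadius (fun p : Fin 2 → ℝ => -K.eval p) μ) θ| ≤ R₁)
    (hR₂ : |deriv (deriv (perturbedFermiRadius (fun p : Fin 2 → ℝ => -K.eval p) μ)) θ| ≤ R₂) :
    |deriv (deriv (deriv (perturbedFermiRadius (fun p : Fin 2 → ℝ => -K.eval p) μ))) θ| ≤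
      ((4 + 8 * A₃) * (R₁ + π * Real.sqrt 2) ^ 3 + 3 * (4 + 4 * A) * (R₁ + π * Real.sqrt 2) * (R₂ + 2 * R₁ + π * Real.sqrt 2) +
          (4 + 2 * A) * (3 * R₂ + 3 * R₁ + π * Real.sqrt 2)) / (B.Dtmin - 2 * A) := by
  obtain ⟨hC, hδ, hκ, hκ₂, hroot⟩ := frame_band_data B hA hlo hhi
  exact abs_deriv_three_le_of_isRoot B hC hδ hlo hhi hκ hADt hroot hκ₂ (fun k _ => norm_fderiv_three_frameShift_le hA₃ k) hR₁ hR₂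

/-- **Order 4 of the frame's Fermi radius, SHARP (linear in `A₃` and in `A₄`)**: from `|u_K′ θ| ≤ R₁`, `|u_K″ θ| ≤ R₂`, `|u_K‴ θ| ≤ R₃`
and the order-3/4 sizes `‖D³(frameShift K)‖ ≤ A₃`, `‖D⁴(frameShift K)‖ ≤ A₄`, with `K₁ = R₁+π√2`, `K₂ = R₂+2R₁+π√2`,
`K₃ = R₃+3R₂+3R₁+π√2`:
`|u_K⁗ θ| ≤ ((4+16A₄)K₁⁴ + 6(4+8A₃)K₁²K₂ + 3(4+4A)K₂² + 4(4+4A)K₁K₃ + (4+2A)(4R₃+6R₂+4R₁+π√2))/(Dt_min − 2A)`.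
[cite: BenfattoGiulianiMastropietro2006, §2.4 Lemma 2.1 (2.40)] -/
theorem abs_deriv_four_frameRadius_le {A₃ A₄ : ℝ} (hA₃ : ∀ p : Momentum, ‖iteratedFDeriv ℝ 3 (frameShift K) p‖ ≤ A₃)
    (hA₄ : ∀ p : Momentum, ‖iteratedFDeriv ℝ 4 (frameShift K) p‖ ≤ A₄)
    {θ R₁ R₂ R₃ : ℝ} (hR₁ : |deriv (perturbedFermiRadius (fun p : Fin 2 → ℝ => -K.eval p) μ) θ| ≤ R₁)
    (hR₂ : |deriv (deriv (perturbedFermiRadius (fun p : Fin 2 → ℝ => -K.eval p) μ)) θ| ≤ R₂)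
    (hR₃ : |deriv (deriv (deriv (perturbedFermiRadius (fun p : Fin 2 → ℝ => -K.eval p) μ))) θ| ≤ R₃) :
    |deriv (deriv (deriv (deriv (perturbedFermiRadius (fun p : Fin 2 → ℝ => -K.eval p) μ)))) θ| ≤
      ((4 + 16 * A₄) * (R₁ + π * Real.sqrt 2) ^ 4 +
            6 * (4 + 8 * A₃) * (R₁ + π * Real.sqrt 2) ^ 2 * (R₂ + 2 * R₁ + π * Real.sqrt 2) +
            3 * (4 + 4 * A) * (R₂ + 2 * R₁ + π * Real.sqrt 2) ^ 2 +
            4 * (4 + 4 * A) * (R₁ + π * Real.sqrt 2) * (R₃ + 3 * R₂ + 3 * R₁ + π * Real.sqrt 2) +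
          (4 + 2 * A) * (4 * R₃ + 6 * R₂ + 4 * R₁ + π * Real.sqrt 2)) / (B.Dtmin - 2 * A) := by
  obtain ⟨hC, hδ, hκ, hκ₂, hroot⟩ := frame_band_data B hA hlo hhi
  exact abs_deriv_four_le_of_isRoot B hC hδ hlo hhi hκ hADt hroot hκ₂ (fun k _ => norm_fderiv_three_frameShift_le hA₃ k)
    (fun k _ => norm_fderiv_four_frameShift_le hA₄ k) hR₁ hR₂ hR₃

end Frame

/-! ## §3 Keyed by `FrameOK` in the KL regime: the sizes that enter, and their growth in the number of scales -/

/-- **The frame data of an admissible frame in the KL regime.**  For every `R` (`Gfr ≥ 0`) there are `c₃, U₀ > 0` such that for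
`0 < c ≤ c₃`, `0 < U ≤ U₀`, `klBetaMin ≤ β ≤ e^{c/U²}`, every `μ ∈ klWindowC` and every `FrameOK R U (nScales β) μ K` frame: with
`A := 2Gfr₀|U| + 2Gfr₁U² + Gfr₂·c/log 4` one has the `C²` size `‖Dʲ(frameShift K)‖ ≤ A` (`j ≤ 2`), `A ≤ 1/20`, `2A < Dt_min` AND
`Dt_min/2 ≤ Dt_min − 2A` for `B = bandBounds` of the window `[-1.1, -0.1]`, the margins `-1.1 ≤ μ − A`, `μ + A ≤ -0.1`, and the SHARP
order-3/4 sizes `‖D³(frameShift K)‖ ≤ Gfr₃·U²·4^{N+1}/3`, `‖D⁴(frameShift K)‖ ≤ Gfr₄·U²·16^{N+1}/15` (`N = nScales β`) — exactly the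
inputs of §2 (`abs_deriv_frameRadius_le_uniform`, `abs_deriv_two/three/four_frameRadius_le`), whose outputs are then `O(1)`, `O(1)`,
`O(1 + Gfr₃U²4^N)`, `O(1 + Gfr₃U²4^N + Gfr₄U²4^{2N})` uniformly in the frame, the volume and the angle. -/
theorem frame_sizes_of_frameOK (R : RenConsts) (hR : ∀ j, 0 ≤ R.Gfr j) :
    ∃ c₃ : ℝ, 0 < c₃ ∧ ∃ U₀ : ℝ, 0 < U₀ ∧
      ∀ c : ℝ, 0 < c → c ≤ c₃ → ∀ U : ℝ, 0 < U → U ≤ U₀ → ∀ β : ℝ, klBetaMin ≤ β → β ≤ Real.exp (c / U ^ 2) →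
      ∀ μ ∈ klWindowC, ∀ K : TrigPolyC4v, FrameOK R U (nScales β) μ K →
        (∀ p : Momentum, ∀ j ≤ 2, ‖iteratedFDeriv ℝ j (frameShift K) p‖ ≤
            2 * R.Gfr 0 * |U| + 2 * R.Gfr 1 * U ^ 2 + R.Gfr 2 * (c / Real.log 4)) ∧
        2 * R.Gfr 0 * |U| + 2 * R.Gfr 1 * U ^ 2 + R.Gfr 2 * (c / Real.log 4) ≤ 1 / 20 ∧
        2 * (2 * R.Gfr 0 * |U| + 2 * R.Gfr 1 * U ^ 2 + R.Gfr 2 * (c / Real.log 4)) <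
          (bandBounds (show (-4 : ℝ) < -1.1 by norm_num) (show (-1.1 : ℝ) ≤ -0.1 by norm_num)
            (show (-0.1 : ℝ) < 0 by norm_num)).Dtmin ∧
        (bandBounds (show (-4 : ℝ) < -1.1 by norm_num) (show (-1.1 : ℝ) ≤ -0.1 by norm_num)
            (show (-0.1 : ℝ) < 0 by norm_num)).Dtmin / 2 ≤
          (bandBounds (show (-4 : ℝ) < -1.1 by norm_num) (show (-1.1 : ℝ) ≤ -0.1 by norm_num)
            (show (-0.1 : ℝ) < 0 by norm_num)).Dtmin -
            2 * (2 * R.Gfr 0 * |U| + 2 * R.Gfr 1 * U ^ 2 + R.Gfr 2 * (c / Real.log 4)) ∧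
        ((-1.1 : ℝ) ≤ μ - (2 * R.Gfr 0 * |U| + 2 * R.Gfr 1 * U ^ 2 + R.Gfr 2 * (c / Real.log 4)) ∧
          μ + (2 * R.Gfr 0 * |U| + 2 * R.Gfr 1 * U ^ 2 + R.Gfr 2 * (c / Real.log 4)) ≤ -0.1) ∧
        (∀ p : Momentum, ‖iteratedFDeriv ℝ 3 (frameShift K) p‖ ≤ R.Gfr 3 * U ^ 2 * ((4 : ℝ) ^ (nScales β + 1) / 3)) ∧
        (∀ p : Momentum, ‖iteratedFDeriv ℝ 4 (frameShift K) p‖ ≤ R.Gfr 4 * U ^ 2 * ((16 : ℝ) ^ (nScales β + 1) / 15)) := by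
  have ha : (-4 : ℝ) < -1.1 := by norm_num
  have hab : (-1.1 : ℝ) ≤ -0.1 := by norm_num
  have hb : (-0.1 : ℝ) < 0 := by norm_num
  set B := bandBounds ha hab hb with hBdef
  have hDt := B.Dtmin_pos
  set κ : ℝ := min B.Dtmin (1 / 5) with hκdef
  have hκ : 0 < κ := lt_min hDt (by norm_num)
  obtain ⟨c₃, hc₃, U₀, hU₀, hthr⟩ := frame_thresholds hR hκ
  refine ⟨c₃, hc₃, U₀, hU₀, ?_⟩
  intro c hc hcle U hU hUle β hβmin hβc μ hμ K hK
  have hAf : ∀ p : Momentum, ∀ j ≤ 2, ‖iteratedFDeriv ℝ j (frameShift K) p‖ ≤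
      2 * R.Gfr 0 * |U| + 2 * R.Gfr 1 * U ^ 2 + R.Gfr 2 * (c / Real.log 4) := fun p j hj =>
    norm_iteratedFDeriv_frameShift_le_of_frameOK_regime hR hc.le hβmin hβc hK p hj
  set A := 2 * R.Gfr 0 * |U| + 2 * R.Gfr 1 * U ^ 2 + R.Gfr 2 * (c / Real.log 4) with hAdef
  have h4A : 4 * A ≤ κ := hthr c U hc.le hcle hU hUle
  have hA0 : 0 ≤ A := le_trans (norm_nonneg _) (hAf 0 0 (by norm_num))
  have hκ1 : κ ≤ B.Dtmin := min_le_left _ _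
  have hκ2 : κ ≤ 1 / 5 := min_le_right _ _
  have hA20 : A ≤ 1 / 20 := by linarith
  have hADt : 2 * A < B.Dtmin := by linarith
  have hhalf : B.Dtmin / 2 ≤ B.Dtmin - 2 * A := by linarith
  obtain ⟨hlo, hhi⟩ := klWindowC_margin hμ hA20
  have hU2 : uPow 3 U = U ^ 2 := uPow_succ 2 U
  have hU2' : uPow 4 U = U ^ 2 := uPow_succ 3 U
  have h3 : ∀ p : Momentum, ‖iteratedFDeriv ℝ 3 (frameShift K) p‖ ≤ R.Gfr 3 * U ^ 2 * ((4 : ℝ) ^ (nScales β + 1) / 3) := by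
    intro p
    refine (norm_iteratedFDeriv_frameShift_le_sum_of_frameOK hK p (by norm_num)).trans ?_
    rw [← Finset.mul_sum, hU2]
    exact mul_le_mul_of_nonneg_left (sum_four_zpow_order_three_le _) (mul_nonneg (hR 3) (sq_nonneg U))
  have h4 : ∀ p : Momentum, ‖iteratedFDeriv ℝ 4 (frameShift K) p‖ ≤ R.Gfr 4 * U ^ 2 * ((16 : ℝ) ^ (nScales β + 1) / 15) := by
    intro p
    refine (norm_iteratedFDeriv_frameShift_le_sum_of_frameOK hK p le_rfl).trans ?_
    rw [← Finset.mul_sum, hU2']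
    exact mul_le_mul_of_nonneg_left (sum_four_zpow_order_four_le _) (mul_nonneg (hR 4) (sq_nonneg U))
  exact ⟨hAf, hA20, hADt, hhalf, ⟨hlo, hhi⟩, h3, h4⟩

end Summit.HubbardSuperconductivity.HubbardSuperconductivity.Theorems.PerturbedFermiCurve

end
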